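import Mathlib
import HarnessLib
import Summits.QuantumAdvantage.QuantumAdvantage.Theorems.RigidityLawsA
import Summits.QuantumAdvantage.QuantumAdvantage.Theorems.RegisterRotationA
import Summits.QuantumAdvantage.QuantumAdvantage.Theorems.RelativeSmolensky
import Summits.QuantumAdvantage.AdviceFreeQNC0.WalkTransport
import Summits.QuantumAdvantage.AdviceFreeQNC0.WalkTubeRank
import Summits.QuantumAdvantage.AdviceFreeQNC0.EliminationLogDegree

set_option linter.dupNamespace false
set_option autoImplicit false

/-!
# TallyDial (A) — the shot-parity dial of the u-walk game collapses: the NULL COMB (cell decomp-qadv, lens 4, g17)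

Prop-definition-free tree twin of the lens-4 g17 node `TallyDial` (supports of item stmt-QuantumAdvantage-28489
`AbsorptionDial.MassHiQuarter`, whose conclusion is T = `AbsorptionDial.WalkPolyLossOdd` = stmt 26767; T appears here only
INLINE, in `wild_iff_polyLoss`).  Everything is stated for the u-WALK family `ringWinU` and an arbitrary prime `p` through
`HasDegF`.

* §1 the shot tally `tally y u = #{g : y_g(u) = 1}` and its parity `shotParity` (THE DIAL: tame = polylog `𝔽_p`-degree,
  wild = not); TALLY LAW `shotParity_xorStrat : μ_{y⊕z} = μ_y ⊕ μ_z`.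
* §3 saturation: `tame_xorStrat`, `wild_xorStrat`, pair twists have shot parity `0` (`shotParity_pairFire`).
* §4 THE NULL COMB: the window triple (cuts `a,a+1,a+2` fired iff `u_a = u_{a+1} = 1`) is EXACTLY NULL at every charge
  (`ringWinU_triple`: labels `ℓ, ℓ+2, ℓ+4`), degree 2, shot parity = window; the comb `comb n = ⊕_b triple(3b)` is null
  (`ringWinU_comb`), cut degree 2 (`hasDegF_comb`), and `μ_comb ∘ sub = PARITY_{⌊(n+1)/3⌋}` (`shotParity_comb_sub`);
  `parity_not_hasDegF : 16(d+1)² ≤ m → ¬ HasDegF p PARITY_m d` (`p ≠ 2`, from `PairFreezing.relBal_three_of_sq_le`;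
  cf. the sharper block wall `AbsorptionDialD.not_hasDegF_parityAnd`).
* §5 THE COLLAPSE `tame_of_wild` / `wild_iff_polyLoss`: «T restricted to WILD strategies» ⟺ T — `y ↦ y ⊕ comb` is a
  win-preserving degree-`+2` injection of tame into wild.  Consequently the tame/wild dichotomy is no decomposition of T
  (negative knowledge for item 28489; law «absolute null twists»: a per-strategy piece of T must depend on `y` only
  through its win function and degree).
* §6 `tame_two`: at `p = 2` every strategy is tame.

0 sorry; axioms standard; no `instance`, no `notation`, no `native_decide`; no `def … : Prop`.
-/

open Finset
open Literature.Computability.MetaComplexity Literature.Computability.MetaComplexity.Smolensky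
open Literature.Computability.Complexity (parityFn)
open Summit.QuantumAdvantage.AdviceFreeQNC0

namespace Summit.QuantumAdvantage.QuantumAdvantage.Theorems.TallyDial

variable {n : ℕ}

/-! ## §1 The tally, its parity, and the TALLY LAW -/

/-- the shot tally `M_y(u)`: the number of cuts `y` fires at input `u`. -/
def tally (y : Fin (n + 1) → (Fin n → Bool) → Bool) (u : Fin n → Bool) : ℕ :=
  (univ.filter fun g : Fin (n + 1) => y g u = true).card

/-- the shot parity `μ_y(u) = M_y(u) mod 2` — THE DIAL. -/
def shotParity (y : Fin (n + 1) → (Fin n → Bool) → Bool) (u : Fin n → Bool) : Bool :=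
  decide (tally y u % 2 = 1)

/-- TallyDialAA helper `xor_decide_of_sum` (decomp-qadv land package; see the module docstring). -/
private theorem xor_decide_of_sum {A B C F : ℕ} (h : A + B + C = 2 * F) :
    Bool.xor (decide (A % 2 = 1)) (decide (B % 2 = 1)) = decide (C % 2 = 1) := by
  rcases Nat.mod_two_eq_zero_or_one A with ha | ha <;> rcases Nat.mod_two_eq_zero_or_one B with hb | hb <;>
    rcases Nat.mod_two_eq_zero_or_one C with hc | hc <;> simp [ha, hb, hc] <;> omega

/-- **THE TALLY LAW** `μ_{y ⊕ z} = μ_y ⊕ μ_z` (the fired set of `y ⊕ z` is the symmetric difference). -/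
theorem shotParity_xorStrat (y z : Fin (n + 1) → (Fin n → Bool) → Bool) (u : Fin n → Bool) :
    shotParity (RigidityLaws.xorStrat y z) u = Bool.xor (shotParity y u) (shotParity z u) := by
  unfold shotParity tally
  set A := univ.filter fun g : Fin (n + 1) => y g u = true with hA
  set B := univ.filter fun g : Fin (n + 1) => z g u = true with hB
  have hX : (univ.filter fun g : Fin (n + 1) => RigidityLaws.xorStrat y z g u = true) = (A \ B) ∪ (B \ A) := by
    ext g
    simp only [RigidityLaws.xorStrat, hA, hB, mem_filter, mem_univ, true_and, mem_union, mem_sdiff]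
    cases y g u <;> cases z g u <;> simp
  have hdisj : Disjoint (A \ B) (B \ A) := by
    rw [Finset.disjoint_left]
    intro g h1 h2
    rw [mem_sdiff] at h1 h2
    exact h1.2 h2.1
  rw [hX, card_union_of_disjoint hdisj]
  have h1 := Finset.card_sdiff_add_card_inter A B
  have h2 := Finset.card_sdiff_add_card_inter B A
  rw [inter_comm B A] at h2
  symm
  exact xor_decide_of_sum (F := (A \ B).card + (B \ A).card + (A ∩ B).card) (by omega)

/-! ## §3 Saturation: both classes are closed under twists of polylog shot parity -/

/-- tame ⊕ tame = tame (degrees add). -/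
theorem tame_xorStrat {p : ℕ} [Fact p.Prime] {d d' : ℕ} {y z : Fin (n + 1) → (Fin n → Bool) → Bool}
    (hy : HasDegF p (shotParity y) d) (hz : HasDegF p (shotParity z) d') :
    HasDegF p (shotParity (RigidityLaws.xorStrat y z)) (d + d') := by
  have key : shotParity (RigidityLaws.xorStrat y z) = fun u => Bool.xor (shotParity y u) (shotParity z u) :=
    funext (shotParity_xorStrat y z)
  rw [key]
  exact RigidityLaws.hasDegF_xor hy hz

/-- `(y ⊕ z) ⊕ z = y`. -/
theorem xorStrat_xorStrat_cancel (y z : Fin (n + 1) → (Fin n → Bool) → Bool) :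
    RigidityLaws.xorStrat (RigidityLaws.xorStrat y z) z = y := by
  funext g u
  simp [RigidityLaws.xorStrat]

/-- `y ⊕ (y ⊕ z) = z`. -/
theorem xorStrat_self_xorStrat (y z : Fin (n + 1) → (Fin n → Bool) → Bool) :
    RigidityLaws.xorStrat y (RigidityLaws.xorStrat y z) = z := by
  funext g u
  simp [RigidityLaws.xorStrat]

/-- wild ⊕ tame = wild (with the degree shift that makes the wild exponent existential). -/
theorem wild_xorStrat {p : ℕ} [Fact p.Prime] {d d' : ℕ} {y z : Fin (n + 1) → (Fin n → Bool) → Bool}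
    (hy : ¬ HasDegF p (shotParity y) (d + d')) (hz : HasDegF p (shotParity z) d') :
    ¬ HasDegF p (shotParity (RigidityLaws.xorStrat y z)) d := by
  intro h
  apply hy
  have h2 := tame_xorStrat h hz
  rwa [xorStrat_xorStrat_cancel] at h2

/-- a PAIR TWIST: cuts `a ≠ b` fired together on the region `r` (null pairs, pads and absorbing pairs of the lineage
are of this shape or XORs of such). -/
def pairFire (a b : Fin (n + 1)) (r : (Fin n → Bool) → Bool) : Fin (n + 1) → (Fin n → Bool) → Bool :=
  fun g u => decide (g = a ∨ g = b) && r u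

/-- a pair twist has shot parity `0`. -/
theorem shotParity_pairFire {a b : Fin (n + 1)} (hab : a ≠ b) (r : (Fin n → Bool) → Bool) (u : Fin n → Bool) :
    shotParity (pairFire a b r) u = false := by
  unfold shotParity tally pairFire
  cases hr : r u
  · simp
  · have hset : (univ.filter fun g : Fin (n + 1) => (decide (g = a ∨ g = b) && true) = true) = {a, b} := by
      ext g
      simp
    rw [hset, card_insert_of_notMem (by simpa using hab), card_singleton]
    decide

/-- so pair twists preserve the tame class exactly (and, by `wild_xorStrat` with `d' = 0`, the wild class). -/
theorem tame_xorStrat_pairFire {p : ℕ} [Fact p.Prime] {d : ℕ} {y : Fin (n + 1) → (Fin n → Bool) → Bool}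
    (hy : HasDegF p (shotParity y) d) {a b : Fin (n + 1)} (hab : a ≠ b) (r : (Fin n → Bool) → Bool) :
    HasDegF p (shotParity (RigidityLaws.xorStrat y (pairFire a b r))) d := by
  have hz : HasDegF p (shotParity (pairFire a b r)) 0 := by
    have : shotParity (pairFire a b r) = fun _ : Fin n → Bool => false := funext (shotParity_pairFire hab r)
    rw [this]
    exact RigidityLaws.hasDegF_const p false 0
  simpa using tame_xorStrat hy hz

/-! ## §4 THE NULL COMB: an exactly null strategy of cut degree 2 with WILD shot parity -/

/-- `W_{<j+1}(u) = W_{<j}(u) + [u_j]`. -/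
private theorem wtPrefix_succ (u : Fin n → Bool) {j : ℕ} (hj : j < n) :
    wtPrefix u (j + 1) = wtPrefix u j + (if u ⟨j, hj⟩ then 1 else 0) := by
  unfold wtPrefix
  have hsplit : (univ.filter fun i : Fin n => i.val < j + 1 ∧ u i = true)
      = (univ.filter fun i : Fin n => i.val < j ∧ u i = true) ∪
        (univ.filter fun i : Fin n => i = ⟨j, hj⟩ ∧ u i = true) := by
    ext i
    simp only [mem_filter, mem_univ, true_and, mem_union, Fin.ext_iff]
    constructor
    · rintro ⟨h1, h2⟩
      by_cases h : i.val < j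
      · exact Or.inl ⟨h, h2⟩
      · exact Or.inr ⟨by omega, h2⟩
    · rintro (⟨h1, h2⟩ | ⟨h1, h2⟩)
      · exact ⟨by omega, h2⟩
      · exact ⟨by omega, h2⟩
  have hdisj : Disjoint (univ.filter fun i : Fin n => i.val < j ∧ u i = true)
      (univ.filter fun i : Fin n => i = ⟨j, hj⟩ ∧ u i = true) := by
    rw [Finset.disjoint_left]
    intro i h1 h2
    rw [mem_filter] at h1 h2
    have := h2.2.1
    rw [Fin.ext_iff] at this
    simp at this
    omega
  rw [hsplit, card_union_of_disjoint hdisj]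
  congr 1
  cases hu : u ⟨j, hj⟩
  · have : (univ.filter fun i : Fin n => i = ⟨j, hj⟩ ∧ u i = true) = ∅ := by
      ext i
      simp only [mem_filter, mem_univ, true_and, Finset.notMem_empty, iff_false, not_and]
      intro hi
      rw [hi, hu]
      simp
    rw [this]
    simp
  · have : (univ.filter fun i : Fin n => i = ⟨j, hj⟩ ∧ u i = true) = {⟨j, hj⟩} := by
      ext i
      simp only [mem_filter, mem_univ, true_and, mem_singleton]
      constructor
      · exact fun h => h.1
      · intro hi
        exact ⟨hi, by rw [hi, hu]⟩
    rw [this]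
    simp

/-- `e_{j+1}(u) = e_j(u) + [u_j]` for the walk exponent. -/
theorem walkExp_succ (u : Fin n → Bool) {j : ℕ} (hj : j < n) :
    walkExp u (j + 1) = walkExp u j + (if u ⟨j, hj⟩ then 1 else 0) := by
  unfold walkExp
  rw [wtPrefix_succ u hj]
  ring

/-- the twin-ones window at position `a`: `u_a = u_{a+1} = 1`. -/
def twin (a : ℕ) (ha : a + 2 ≤ n) (u : Fin n → Bool) : Bool :=
  u ⟨a, by omega⟩ && u ⟨a + 1, by omega⟩

/-- the WINDOW TRIPLE: cuts `a, a+1, a+2` fired together exactly on the twin-ones window. -/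
def triple (a : ℕ) (ha : a + 2 ≤ n) : Fin (n + 1) → (Fin n → Bool) → Bool :=
  fun g u => decide (a ≤ g.val ∧ g.val ≤ a + 2) && twin a ha u

/-- a literal has degree `1`. -/
theorem hasDegF_bit {p : ℕ} [Fact p.Prime] (i : Fin n) : HasDegF p (fun u : Fin n → Bool => u i) 1 := by
  unfold HasDegF
  exact bitFn_mem_lowDeg i le_rfl

/-- a conjunction of two literals has degree `1 + 1`. -/
theorem hasDegF_bit_and_bit {p : ℕ} [Fact p.Prime] (i j : Fin n) :
    HasDegF p (fun u : Fin n → Bool => u i && u j) (1 + 1) :=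
  RegisterRotation.hasDegF_and (hasDegF_bit (p := p) i) (hasDegF_bit (p := p) j)

/-- the window is such a conjunction. -/
theorem twin_eq (a : ℕ) (ha : a + 2 ≤ n) :
    twin a ha = fun u : Fin n → Bool => u ⟨a, by omega⟩ && u ⟨a + 1, by omega⟩ := rfl

/-- the window has degree `2`. -/
theorem hasDegF_twin {p : ℕ} [Fact p.Prime] (a : ℕ) (ha : a + 2 ≤ n) : HasDegF p (twin a ha) 2 := by
  have h := hasDegF_bit_and_bit (p := p) (⟨a, by omega⟩ : Fin n) ⟨a + 1, by omega⟩
  norm_num at h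
  rw [twin_eq]
  exact h

/-- the triple has cut degree `2`. -/
theorem hasDegF_triple {p : ℕ} [Fact p.Prime] (a : ℕ) (ha : a + 2 ≤ n) (g : Fin (n + 1)) :
    HasDegF p (triple a ha g) 2 := by
  unfold triple
  cases hg : decide (a ≤ g.val ∧ g.val ≤ a + 2)
  · simpa using RigidityLaws.hasDegF_const p false 2
  · simpa using hasDegF_twin (p := p) a ha

/-- off the window the triple fires nothing. -/
theorem filter_triple_off {a : ℕ} {ha : a + 2 ≤ n} {u : Fin n → Bool} (hw : twin a ha u = false)
    (P : Fin (n + 1) → Prop) [DecidablePred P] :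
    (univ.filter fun g : Fin (n + 1) => triple a ha g u = true ∧ P g) = ∅ := by
  ext g
  simp [triple, hw]

/-- on the window the triple fires exactly the three cuts `a, a+1, a+2`. -/
theorem filter_triple_on {a : ℕ} {ha : a + 2 ≤ n} {u : Fin n → Bool} (hw : twin a ha u = true) :
    (univ.filter fun g : Fin (n + 1) => triple a ha g u = true) =
      {⟨a, by omega⟩, ⟨a + 1, by omega⟩, ⟨a + 2, by omega⟩} := by
  ext g
  simp only [triple, hw, Bool.and_true, decide_eq_true_eq, mem_filter, mem_univ, true_and, mem_insert,
    mem_singleton, Fin.ext_iff]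
  constructor
  · intro h; omega
  · intro h; omega

/-- the three cuts are distinct: the fired set has three elements. -/
theorem card_three (a : ℕ) (ha : a + 2 ≤ n) :
    ({⟨a, by omega⟩, ⟨a + 1, by omega⟩, ⟨a + 2, by omega⟩} : Finset (Fin (n + 1))).card = 3 := by
  rw [card_insert_of_notMem, card_insert_of_notMem, card_singleton]
  · simp [Fin.ext_iff]
  · simp [Fin.ext_iff]

/-- the triple's shot parity IS the window indicator (tally `3` or `0`). -/
theorem shotParity_triple (a : ℕ) (ha : a + 2 ≤ n) (u : Fin n → Bool) :
    shotParity (triple a ha) u = twin a ha u := by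
  unfold shotParity tally
  cases hw : twin a ha u
  · have h0 : (univ.filter fun g : Fin (n + 1) => triple a ha g u = true) = ∅ := by
      ext g
      simp [triple, hw]
    rw [h0]
    simp
  · rw [filter_triple_on hw, card_three a ha]
    decide

/-- **THE TRIPLE IS EXACTLY NULL**: on the twin-ones window the three labels are `ℓ, ℓ+2, ℓ+4` — all residues
mod `3` — so exactly two fired cuts are live; off the window nothing fires. -/
theorem ringWinU_triple (c a : ℕ) (ha : a + 2 ≤ n) (u : Fin n → Bool) : ringWinU c (triple a ha) u = false := by
  unfold ringWinU
  cases hw : twin a ha u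
  · rw [filter_triple_off hw]
    simp
  · have hua : u ⟨a, by omega⟩ = true := by
      simp only [twin, Bool.and_eq_true] at hw; exact hw.1
    have hua1 : u ⟨a + 1, by omega⟩ = true := by
      simp only [twin, Bool.and_eq_true] at hw; exact hw.2
    have h1 : walkExp u (a + 1) = walkExp u a + 1 := by
      rw [walkExp_succ u (by omega : a < n)]; simp [hua]
    have h2 : walkExp u (a + 2) = walkExp u a + 2 := by
      rw [show a + 2 = (a + 1) + 1 from rfl, walkExp_succ u (by omega : a + 1 < n), h1]; simp [hua1]
    have hS : (univ.filter fun g : Fin (n + 1) => triple a ha g u = true ∧ (c + g.val + walkExp u g.val) % 3 ≠ 0)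
        = ({⟨a, by omega⟩, ⟨a + 1, by omega⟩, ⟨a + 2, by omega⟩} : Finset (Fin (n + 1))).filter
            fun g => (c + g.val + walkExp u g.val) % 3 ≠ 0 := by
      rw [← filter_triple_on hw, filter_filter]
    rw [hS, Finset.card_filter, sum_insert, sum_insert, sum_singleton]
    · rw [h1, h2]
      have key : ((if (c + a + walkExp u a) % 3 ≠ 0 then 1 else 0) +
          ((if (c + (a + 1) + (walkExp u a + 1)) % 3 ≠ 0 then 1 else 0) +
            (if (c + (a + 2) + (walkExp u a + 2)) % 3 ≠ 0 then 1 else 0)) : ℕ) = 2 := by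
        split_ifs <;> omega
      rw [key]
      decide
    · simp [Fin.ext_iff]
    · simp [Fin.ext_iff]

/-- number of comb blocks: `b` with `3b + 2 ≤ n`, i.e. `b < ⌊(n+1)/3⌋`. -/
def blocks (n : ℕ) : ℕ := (n + 1) / 3

/-- TallyDialAA helper `three_mul_add_two_le` (decomp-qadv land package; see the module docstring). -/
theorem three_mul_add_two_le {b : ℕ} (hb : b < blocks n) : 3 * b + 2 ≤ n := by
  unfold blocks at hb; omega

/-- the triple of block `b` (as a total family in `a = 3b`; silent when the block does not fit). -/
def tripleAt (a : ℕ) : Fin (n + 1) → (Fin n → Bool) → Bool :=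
  fun g u => if h : a + 2 ≤ n then triple a h g u else false

/-- the XOR of a finite family of strategies. -/
def xorFam {ι : Type*} (s : Finset ι) (F : ι → Fin (n + 1) → (Fin n → Bool) → Bool) :
    Fin (n + 1) → (Fin n → Bool) → Bool :=
  fun g u => decide ((s.filter fun i => F i g u = true).card % 2 = 1)

/-- TallyDialAA helper `xorFam_empty` (decomp-qadv land package; see the module docstring). -/
theorem xorFam_empty {ι : Type*} (F : ι → Fin (n + 1) → (Fin n → Bool) → Bool) :
    xorFam (∅ : Finset ι) F = fun _ _ => false := by
  funext g u
  simp [xorFam]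

/-- TallyDialAA helper `xorFam_insert` (decomp-qadv land package; see the module docstring). -/
theorem xorFam_insert {ι : Type*} [DecidableEq ι] {a : ι} {s : Finset ι} (ha : a ∉ s)
    (F : ι → Fin (n + 1) → (Fin n → Bool) → Bool) :
    xorFam (insert a s) F = RigidityLaws.xorStrat (F a) (xorFam s F) := by
  funext g u
  unfold xorFam RigidityLaws.xorStrat
  rw [filter_insert]
  cases h : F a g u
  · simp
  · rw [if_pos rfl, card_insert_of_notMem (fun hm => ha (mem_filter.mp hm).1)]
    rcases Nat.mod_two_eq_zero_or_one ((s.filter fun i => F i g u = true).card) with hk | hk <;>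
      simp [Nat.add_mod, hk]

/-- the XOR of exactly null strategies is exactly null (character law `WIN(y ⊕ y') = WIN y ⊕ WIN y'`). -/
theorem ringWinU_xorFam_null {ι : Type*} [DecidableEq ι] (c : ℕ) (s : Finset ι)
    (F : ι → Fin (n + 1) → (Fin n → Bool) → Bool) (hF : ∀ i ∈ s, ∀ u, ringWinU c (F i) u = false)
    (u : Fin n → Bool) : ringWinU c (xorFam s F) u = false := by
  induction s using Finset.induction_on with
  | empty =>
    rw [xorFam_empty]
    unfold ringWinU
    simp
  | insert a s ha ih =>
    rw [xorFam_insert ha, RigidityLaws.ringWinU_xorStrat, hF a (mem_insert_self a s) u,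
      ih fun i hi => hF i (mem_insert_of_mem hi)]
    rfl


end Summit.QuantumAdvantage.QuantumAdvantage.Theorems.TallyDial
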